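import Literature.AlgebraicGeometry.Surfaces.K3NikulinInvolution
import Literature.AlgebraicGeometry.Surfaces.K3Surface
import Literature.AlgebraicGeometry.Surfaces.K3PeriodSurjectivity
import HarnessLib

/-!
# A primitive `E₈(−2)` in the Néron–Severi lattice gives a Nikulin involution
# (van Geemen–Sarti 2007 §2.1 / Prop. 2.3; Nikulin 1979 Thm. 4.3; Varesco 2023 §2)

Family `hodge`, layer `Literature/AlgebraicGeometry/Surfaces`. NAMED FACT (D-0014) for route
HodgeConjecture/MarkmanPartnerTransport, crux `PicardThreeK3Squares` (stmt-HodgeConjecture-19652):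
consumer `Summits/HodgeConjecture/HodgeConjecture/Theorems/MarkmanPartnerTransportPicardThreeK3SquaresPicardElevenSqrtTwo`
(«every projective K3 surface of Picard rank `≥ 11` is isogenous to one with a Nikulin involution»,
hence HC⁴(S × S) for all K3 surfaces of Picard rank `12, 14, 16` with real multiplication by `ℚ(√2)`
modulo Varesco's Thm. 2.1).

Sources. B. van Geemen, A. Sarti, *Nikulin involutions on K3 surfaces*, Math. Z. 255 (2007) =
arXiv:math/0602015 (held `paper:arxiv-math_0602015`, read at this seat): §2.1 "the Néron Severi group
of `X` contains `E₈(−2) ≅ (H²(X,ℤ)^ι)^⊥` as a primitive sublattice" (the necessity), and the proof of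
Prop. 2.3 (p. 6 of the held text): "The involution of `Λ = ℤL ⊕ E₈(−2)` which is trivial on `L` and
`−1` on `E₈(−2)`, extends … to an involution `ι₀` of `U³ ⊕ E₈(−1)²` which is trivial on `Λ^⊥`. As
`((U³ ⊕ E₈(−1)²)^{ι₀})^⊥ = E₈(−2)` is negative definite, contains no `(−2)`-classes and is contained in
`NS(X)`, results of Nikulin show that `X` has a Nikulin involution `ι` such that `ι^* = ι₀` up to
conjugation by an element of the Weyl group of `X`" (the sufficiency; V. V. Nikulin, *Finite groups of
automorphisms of Kählerian K3 surfaces*, Trudy Moskov. Mat. Obshch. 38 (1979), Thm. 4.3; the extension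
exists because the discriminant group of `E₈(−2)` is `2`-torsion, proof of Prop. 2.2). Stated as an
equivalence by M. Varesco, *Hodge similarities, algebraic classes, and Kuga–Satake varieties*, Math. Z.
305 (2023) = arXiv:2304.02519, §2 (paragraph before Prop. 2.5): "By [vGS07], a K3 surface `X` admits a
Nikulin involution if and only if the lattice `E₈(−2)` is primitively embedded in the Néron–Severi group
of `X`." Huybrechts, *Lectures on K3 Surfaces*, Ch. 15 §4 recalls the setting.

## Rendering

On the tree's carriers, through a marking `η : H²(X(ℂ); ℂ) ≅ Λ_ℂ = ℂ^{K3Index}` of the projective K3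
surface `X` (`IsK3Surface X`) identifying the integral classes with `Λ = ℤ²²` and the cup product with
the K3 form `k3Form` times a class `p` of `H⁴` (the clauses of `Huybrechts_K3_marking_exists` /
`Huybrechts_K3_periodSurjective_projective`): a "primitive embedding `E₈(−2) ↪ NS(X)`" is a family of
eight lattice vectors `v₁, …, v₈ ∈ Λ` with Gram matrix `−2 · E₈` (`k3Gram`, Mathlib's `CartanMatrix.E₈`),
spanning a PRIMITIVE sublattice (a rational combination lying in `Λ` has integral coefficients), whose
classes `η⁻¹(vᵢ)` are algebraic (`∈ algebraicClasses X 1`, i.e. in `NS(X) ⊗ ℂ`; they are integral, so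
in `NS(X)`). Conclusion: `∃ ι, IsNikulinInvolution X ι` (a symplectic involution, `K3NikulinInvolution.lean`).
Only the sufficiency is stated (the direction used by the consumer).

## References

* [VanGeemenSarti2007] B. van Geemen, A. Sarti, Nikulin involutions on K3 surfaces, Math. Z. 255 (2007)
  731–753, §2.1, Prop. 2.2, Prop. 2.3 (proof).
* [Nikulin1979] V. V. Nikulin, Finite groups of automorphisms of Kählerian K3 surfaces, Trudy Moskov.
  Mat. Obshch. 38 (1979) 75–137, Thm. 4.3 — cited through [VanGeemenSarti2007].
* [Varesco2023] M. Varesco, Hodge similarities, algebraic classes, and Kuga–Satake varieties, Math. Z.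
  305 (2023), art. 69, §2 (before Prop. 2.5) and Prop. 2.5.
* [Huybrechts2016K3] D. Huybrechts, Lectures on K3 Surfaces, CUP 2016, Ch. 15 §4, Ch. 14 §0–1.
-/

noncomputable section

open CategoryTheory
open Literature.AlgebraicTopology.SingularHomology

namespace Literature.AlgebraicGeometry.Surfaces

/-- **A projective K3 surface whose Néron–Severi lattice contains a primitive sublattice isometric to
`E₈(−2)` admits a Nikulin involution** (van Geemen–Sarti 2007, §2.1 and the proof of Prop. 2.3: the
involution `−1 ⊕ 1` of `E₈(−2) ⊕ E₈(−2)^⊥` extends to `H²(X, ℤ)` because the discriminant group of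
`E₈(−2)` is `2`-torsion; its anti-invariant lattice `E₈(−2)` is negative definite, without
`(−2)`-classes and contained in `NS(X)`, so "results of Nikulin show that `X` has a Nikulin involution";
Nikulin 1979 Thm. 4.3. Quoted as an equivalence by Varesco 2023, §2: "a K3 surface `X` admits a Nikulin
involution if and only if the lattice `E₈(−2)` is primitively embedded in the Néron–Severi group of
`X`"). Rendering (module docstring): through a marking `η` of `X` (integral classes `↔ Λ = ℤ²²`, cup
product `=` K3 form `• p`), for lattice vectors `v₁, …, v₈ ∈ Λ` with Gram matrix `−2·E₈` spanning a
PRIMITIVE sublattice all of whose classes `η⁻¹(vᵢ)` are algebraic, there is a Nikulin involution on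
`X`. [cite: VanGeemenSarti2007, §2.1 and Prop. 2.3 (proof)] [cite: Varesco2023, §2 (paragraph before Prop. 2.5)]
[cite: Huybrechts2016K3, Ch. 15 §4] -/
def VanGeemenSarti2007_nikulinInvolution_of_primitiveE8 : Prop :=
  ∀ (X : Motives.SchemeOver ℂ), IsK3Surface X →
    ∀ (η : HodgeTheory.complexBetti X (2 * 1) ≃ₗ[ℂ] (K3Index → ℂ)) (p : HodgeTheory.complexBetti X (2 * 2)),
      (∀ c : HodgeTheory.complexBetti X (2 * 1),
        HodgeTheory.IsIntegralClass c ↔ ∃ v : K3Index → ℤ, η c = fun i => (v i : ℂ)) →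
      (∀ a b : HodgeTheory.complexBetti X (2 * 1),
        cupProduct (rfl : 2 * 1 + 2 * 1 = 2 * 2) a b = k3Form (η a) (η b) • p) →
      ∀ (v : Fin 8 → (K3Index → ℤ)),
        (∀ i j : Fin 8, ∑ a, ∑ b, v i a * k3Gram a b * v j b = -2 * CartanMatrix.E₈ i j) →
        (∀ c : Fin 8 → ℚ, (∃ w : K3Index → ℤ, ∀ a, (w a : ℚ) = ∑ i, c i * (v i a : ℚ)) →
          ∀ i, ∃ n : ℤ, c i = n) →
        (∀ i, η.symm (fun a => (v i a : ℂ)) ∈ HodgeTheory.algebraicClasses X 1) →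
        ∃ ι : X ⟶ X, IsNikulinInvolution X ι

/-- Unfolding of `VanGeemenSarti2007_nikulinInvolution_of_primitiveE8` (statement-only file: users
apply the fact directly to marked data `η, p`, lattice vectors `v` and the three clauses).
[cite: VanGeemenSarti2007, Prop. 2.3 (proof)] -/
theorem vanGeemenSarti2007_nikulinInvolution_of_primitiveE8_iff :
    VanGeemenSarti2007_nikulinInvolution_of_primitiveE8 ↔
      ∀ (X : Motives.SchemeOver ℂ), IsK3Surface X →
        ∀ (η : HodgeTheory.complexBetti X (2 * 1) ≃ₗ[ℂ] (K3Index → ℂ)) (p : HodgeTheory.complexBetti X (2 * 2)),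
          (∀ c : HodgeTheory.complexBetti X (2 * 1),
            HodgeTheory.IsIntegralClass c ↔ ∃ v : K3Index → ℤ, η c = fun i => (v i : ℂ)) →
          (∀ a b : HodgeTheory.complexBetti X (2 * 1),
            cupProduct (rfl : 2 * 1 + 2 * 1 = 2 * 2) a b = k3Form (η a) (η b) • p) →
          ∀ (v : Fin 8 → (K3Index → ℤ)),
            (∀ i j : Fin 8, ∑ a, ∑ b, v i a * k3Gram a b * v j b = -2 * CartanMatrix.E₈ i j) →
            (∀ c : Fin 8 → ℚ, (∃ w : K3Index → ℤ, ∀ a, (w a : ℚ) = ∑ i, c i * (v i a : ℚ)) →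
              ∀ i, ∃ n : ℤ, c i = n) →
            (∀ i, η.symm (fun a => (v i a : ℂ)) ∈ HodgeTheory.algebraicClasses X 1) →
            ∃ ι : X ⟶ X, IsNikulinInvolution X ι :=
  Iff.rfl

end Literature.AlgebraicGeometry.Surfaces

end
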